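import Summits.CriticalPhenomena.PercolationContinuityZ3.Theorems.PercNearOneGluingNoHeavyLowerTailSahiDeepCoreHarris
import Literature.Probability.LatticeModels.StrongHarrisKleitman
import Mathlib.Tactic.Linarith
import Mathlib.Tactic.Ring
import HarnessLib

/-!
# `NoHeavyLowerTail` (crux stmt-CriticalPhenomena-4575), master-family line P1: PROVENANCE of the deep-core Harris inequality —
# it is Gladkov's strong Harris–Kleitman inequality with three cells

Support file (seat `prim-masterthm-p1`, gen 10; `--supports stmt-CriticalPhenomena-4575`).  No definition, no `sorry`, standard axioms.
Companion of `…SahiDeepCoreHarris` (whose first instalment's header wrongly called `deepCore_harris` "a new correlation inequality").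

CONTENT.  For increasing `U, V` the partition `A = (U∩V) ∖ D(U,V)`, cells `C = (U ∖ V, V ∖ U, D(U,V))`, `B = (U ∪ V)ᶜ` satisfies the
hypotheses of [cite: Gladkov2024StrongFKG, Thm. 2.1] (`A ∪ C_i` = `U ∖ D`, `V ∖ D`, `U ∩ V` are increasing —
`isUpperSet_diff_deepCore`, `isUpperSet_inter_diff_deepCore`), and the tree's `Literature.Probability.LatticeModels.prodBernoulli_strongHarris`
gives (`gladkov_deepCore`)
  `(u − t)(v − t) + d(u − t) + d(v − t) ≤ (t − d)(1 − (u + v − t))`   (`u, v, t, d = μU, μV, μ(U∩V), μ(D(U,V))`),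
which is `deepCore_harris` (`d(1 − t) ≤ t − uv`) after expanding (`gladkov_three_cells_of_deepCore_harris` is the converse
rewriting).  The deep core is the largest admissible third cell for the pair `(U, V)` (`inter_diff_subset_deepCore`), so the deep-core
form is the optimal `k = 3` instance of Gladkov's theorem; the induction in `…SahiDeepCoreHarris` is an independent proof of that
instance.  HONEST FRAMING: bookkeeping only; no new inequality. [this work]
-/

noncomputable section

open scoped Classical

namespace Summit.CriticalPhenomena.PercolationContinuityZ3.Theorems

namespace SahiDeepCore

open Finset Function
open Literature.Combinatorics.Sahi2008
open Literature.Probability.LatticeModels (prodBernoulli prodBernoulli_strongHarris)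
open Literature.Probability.Percolation.DecisionTree (ind ind_of_mem ind_of_not_mem ind_nonneg)

variable {ι : Type} [Fintype ι]

local notation3 (prettyPrint := false) "m⟦" p ", " X "⟧" => ex (bernoulliWeight p) (ind X)

/-! ### Gladkov's Theorem 2.1 on the deep-core partition -/

omit [Fintype ι] in
/-- `U ∖ D(U,V)` is increasing when `U` is: a separating sub-configuration is inherited upwards. [this work] -/
theorem isUpperSet_diff_deepCore {U : Set (Set ι)} (hU : IsUpperSet U) (V : Set (Set ι)) : IsUpperSet (U \ deepCore U V) := by
  intro ω ω' hle hω
  refine ⟨hU hle hω.1, fun hD => hω.2 ?_⟩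
  by_cases hωV : ω ∈ V
  · exact ⟨⟨hω.1, hωV⟩, fun η hη => hD.2 η (hη.trans hle)⟩
  · exact absurd ((hD.2 ω hle).1 hω.1) hωV

omit [Fintype ι] in
/-- `V ∖ D(U,V)` is increasing when `V` is. [this work] -/
theorem isUpperSet_diff_deepCore' (U : Set (Set ι)) {V : Set (Set ι)} (hV : IsUpperSet V) : IsUpperSet (V \ deepCore U V) := by
  intro ω ω' hle hω
  refine ⟨hV hle hω.1, fun hD => hω.2 ?_⟩
  by_cases hωU : ω ∈ U
  · exact ⟨⟨hωU, hω.1⟩, fun η hη => hD.2 η (hη.trans hle)⟩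
  · exact absurd ((hD.2 ω hle).2 hω.1) hωU

omit [Fintype ι] in
/-- `(U ∩ V) ∖ D(U,V)` is increasing when `U, V` are. [this work] -/
theorem isUpperSet_inter_diff_deepCore {U V : Set (Set ι)} (hU : IsUpperSet U) (hV : IsUpperSet V) :
    IsUpperSet ((U ∩ V) \ deepCore U V) := by
  have h : (U ∩ V) \ deepCore U V = (U \ deepCore U V) ∩ (V \ deepCore U V) := by
    ext ω; simp only [Set.mem_sdiff, Set.mem_inter_iff]; tauto
  rw [h]; exact (isUpperSet_diff_deepCore hU V).inter (isUpperSet_diff_deepCore' U hV)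

/-- `μ_p(Xᶜ) = 1 − μ_p(X)`. [folklore] -/
private theorem m_compl (p : ι → unitInterval) (X : Set (Set ι)) : m⟦p, Xᶜ⟧ = 1 - m⟦p, X⟧ := by
  have h : ind Xᶜ = (fun _ : Set ι => (1 : ℝ)) - ind X := by
    funext ω
    simp only [Pi.sub_apply]
    by_cases hx : ω ∈ X
    · rw [ind_of_mem hx, ind_of_not_mem (show ω ∉ Xᶜ from fun h => (Set.mem_compl_iff X ω).1 h hx)]; norm_num
    · rw [ind_of_not_mem hx, ind_of_mem ((Set.mem_compl_iff X ω).2 hx)]; norm_num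
  rw [h, SahiCombDisjunct.ex_sub', ex_const (sum_bernoulliWeight p)]

/-- `μ_p(A ∖ B) = μ_p(A) − μ_p(A ∩ B)`. [folklore] -/
private theorem m_diff_inter (p : ι → unitInterval) (A B : Set (Set ι)) : m⟦p, A \ B⟧ = m⟦p, A⟧ - m⟦p, A ∩ B⟧ := by
  have h := Pointwise.ex_ind_sub_of_subset (bernoulliWeight p) (Set.inter_subset_left : A ∩ B ⊆ A)
  rw [Set.sdiff_self_inter] at h
  linarith

/-- **Gladkov's Theorem 2.1 (`k = 3`) on the deep-core partition, from the tree's `prodBernoulli_strongHarris`**: with `t = μ(U∩V)`,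
`d = μ(D(U,V))`, `u = μU`, `v = μV`:  `(u − t)(v − t) + d(u − t) + d(v − t) ≤ (t − d)·(1 − (u + v − t))`.  Subtracting shows this is the
SAME inequality as `deepCore_harris` (`⟺ d(1 − t) ≤ t − uv`). [cite: Gladkov2024StrongFKG, Thm. 2.1] -/
theorem gladkov_deepCore (p : ι → unitInterval) {U V : Set (Set ι)} (hU : IsUpperSet U) (hV : IsUpperSet V) :
    (m⟦p, U⟧ - m⟦p, U ∩ V⟧) * (m⟦p, V⟧ - m⟦p, U ∩ V⟧) + m⟦p, deepCore U V⟧ * (m⟦p, U⟧ - m⟦p, U ∩ V⟧)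
        + m⟦p, deepCore U V⟧ * (m⟦p, V⟧ - m⟦p, U ∩ V⟧) ≤
      (m⟦p, U ∩ V⟧ - m⟦p, deepCore U V⟧) * (1 - (m⟦p, U⟧ + m⟦p, V⟧ - m⟦p, U ∩ V⟧)) := by
  set D := deepCore U V with hD
  -- the partition  A = (U ∩ V) ∖ D,  C = (U ∖ V, V ∖ U, D),  B = (U ∪ V)ᶜ
  let C : Fin 3 → Set (Set ι) := ![U \ V, V \ U, D]
  have hC0 : C 0 = U \ V := rfl
  have hC1 : C 1 = V \ U := rfl
  have hC2 : C 2 = D := rfl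
  have hDsub : D ⊆ U ∩ V := deepCore_subset_inter U V
  have hdisj : ∀ i ∈ (Finset.univ : Finset (Fin 3)), ∀ j ∈ (Finset.univ : Finset (Fin 3)), i ≠ j → Disjoint (C i) (C j) := by
    intro i _ j _ hij
    fin_cases i <;> fin_cases j
    all_goals first | exact absurd rfl hij | skip
    · exact Set.disjoint_left.2 fun ω h1 h2 => h1.2 h2.1
    · exact Set.disjoint_left.2 fun ω h1 h2 => h1.2 (hDsub h2).2
    · exact Set.disjoint_left.2 fun ω h1 h2 => h2.2 h1.1
    · exact Set.disjoint_left.2 fun ω h1 h2 => h1.2 (hDsub h2).1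
    · exact Set.disjoint_left.2 fun ω h1 h2 => h2.2 (hDsub h1).2
    · exact Set.disjoint_left.2 fun ω h1 h2 => h2.2 (hDsub h1).1
  have hdisjA : ∀ i ∈ (Finset.univ : Finset (Fin 3)), Disjoint ((U ∩ V) \ D) (C i) := by
    intro i _
    fin_cases i
    · exact Set.disjoint_left.2 fun ω h1 h2 => h2.2 h1.1.2
    · exact Set.disjoint_left.2 fun ω h1 h2 => h2.2 h1.1.1
    · exact Set.disjoint_left.2 fun ω h1 h2 => h1.2 h2
  have hAC0 : (U ∩ V) \ D ∪ (U \ V) = U \ D := by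
    ext ω; simp only [Set.mem_union, Set.mem_sdiff, Set.mem_inter_iff]
    constructor
    · rintro (⟨⟨hU', _⟩, hD'⟩ | ⟨hU', hV'⟩)
      · exact ⟨hU', hD'⟩
      · exact ⟨hU', fun h => hV' (hDsub h).2⟩
    · rintro ⟨hU', hD'⟩
      by_cases hV' : ω ∈ V
      · exact Or.inl ⟨⟨hU', hV'⟩, hD'⟩
      · exact Or.inr ⟨hU', hV'⟩
  have hAC1 : (U ∩ V) \ D ∪ (V \ U) = V \ D := by
    ext ω; simp only [Set.mem_union, Set.mem_sdiff, Set.mem_inter_iff]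
    constructor
    · rintro (⟨⟨_, hV'⟩, hD'⟩ | ⟨hV', hU'⟩)
      · exact ⟨hV', hD'⟩
      · exact ⟨hV', fun h => hU' (hDsub h).1⟩
    · rintro ⟨hV', hD'⟩
      by_cases hU' : ω ∈ U
      · exact Or.inl ⟨⟨hU', hV'⟩, hD'⟩
      · exact Or.inr ⟨hV', hU'⟩
  have hAC2 : (U ∩ V) \ D ∪ D = U ∩ V := by
    rw [Set.sdiff_union_self]; exact Set.union_eq_left.2 hDsub
  have hup : ∀ i ∈ (Finset.univ : Finset (Fin 3)), IsUpperSet ((U ∩ V) \ D ∪ C i) := by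
    intro i _
    fin_cases i
    · change IsUpperSet ((U ∩ V) \ D ∪ (U \ V)); rw [hAC0]; exact isUpperSet_diff_deepCore hU V
    · change IsUpperSet ((U ∩ V) \ D ∪ (V \ U)); rw [hAC1]; exact isUpperSet_diff_deepCore' U hV
    · change IsUpperSet ((U ∩ V) \ D ∪ D); rw [hAC2]; exact hU.inter hV
  have hA : IsUpperSet ((U ∩ V) \ D) := isUpperSet_inter_diff_deepCore hU hV
  have key := prodBernoulli_strongHarris p (Finset.univ : Finset (Fin 3)) hdisj hdisjA hup hA
  -- the bottom cell is `(U ∪ V)ᶜ`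
  have hunion : ((U ∩ V) \ D ∪ ⋃ i ∈ (Finset.univ : Finset (Fin 3)), C i) = U ∪ V := by
    ext ω
    simp only [Set.mem_union, Set.mem_iUnion, Finset.mem_univ, exists_true_left, Set.mem_sdiff, Set.mem_inter_iff]
    constructor
    · rintro (⟨⟨hU', hV'⟩, -⟩ | ⟨i, hi⟩)
      · exact Or.inl hU'
      · fin_cases i
        · exact Or.inl ((show ω ∈ U \ V from hi).1)
        · exact Or.inr ((show ω ∈ V \ U from hi).1)
        · exact Or.inl (hDsub (show ω ∈ D from hi)).1
    · intro h
      by_cases hD' : ω ∈ D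
      · exact Or.inr ⟨2, hD'⟩
      by_cases hU' : ω ∈ U
      · by_cases hV' : ω ∈ V
        · exact Or.inl ⟨⟨hU', hV'⟩, hD'⟩
        · exact Or.inr ⟨0, show ω ∈ U \ V from ⟨hU', hV'⟩⟩
      · have hV' : ω ∈ V := h.resolve_left hU'
        exact Or.inr ⟨1, show ω ∈ V \ U from ⟨hV', hU'⟩⟩
  rw [hunion] at key
  simp only [Fin.sum_univ_three, hC0, hC1, hC2, ← ex_bernoulliWeight_ind] at key
  -- moments of the cells
  rw [m_compl p (U ∪ V), SahiCoSunflowerOrCoordinate.ex_ind_union, m_diff_inter p U V, m_diff_inter p V U, Set.inter_comm V U,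
    m_diff_inter p (U ∩ V) D, Set.inter_eq_right.2 hDsub] at key
  nlinarith [key]

/-- **The converse rewriting**: the deep-core Harris inequality of §3 gives back Gladkov's three-cell inequality for the deep-core
partition (pure algebra: `t(1 − w) − αβ − d(1 − t) = (t − d)(1 − w) − αβ − dα − dβ` since `w = t + α + β`).  So `deepCore_harris`
and `gladkov_deepCore` are the same statement. [cite: Gladkov2024StrongFKG, Thm. 2.1 — corollary] -/
theorem gladkov_three_cells_of_deepCore_harris (p : ι → unitInterval) {U V : Set (Set ι)} (hU : IsUpperSet U) (hV : IsUpperSet V) :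
    (m⟦p, U⟧ - m⟦p, U ∩ V⟧) * (m⟦p, V⟧ - m⟦p, U ∩ V⟧) + m⟦p, deepCore U V⟧ * (m⟦p, U⟧ - m⟦p, U ∩ V⟧)
        + m⟦p, deepCore U V⟧ * (m⟦p, V⟧ - m⟦p, U ∩ V⟧) ≤
      (m⟦p, U ∩ V⟧ - m⟦p, deepCore U V⟧) * (1 - (m⟦p, U⟧ + m⟦p, V⟧ - m⟦p, U ∩ V⟧)) := by
  have h := deepCore_harris p hU hV
  nlinarith [h]


end SahiDeepCore

end Summit.CriticalPhenomena.PercolationContinuityZ3.Theorems
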